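import Literature.NumberTheory.EllipticCurves.ComplexTorusAddProofs
import Mathlib.AlgebraicGeometry.EllipticCurve.Affine.Point
import HarnessLib

/-!
# Division points with algebraic coordinates: the points `ξ(z) = (℘(z) − b₂/12, (℘′(z) − a₁x − a₃)/2)` on an arbitrary model,
# their group law, and the transport of point identities along ring maps (to a local curve)

Topic `NumberTheory/EllipticCurves`; namespaces `PeriodPair` (dot-notation extensions, as in `ComplexTorus.lean`) and
`Literature.NumberTheory.EllipticCurves` (transport lemmas).

For a lattice `Λ ⊂ ℂ` (`L : PeriodPair`) and a Weierstrass MODEL `W/ℂ` with `g₂(Λ) = c₄(W)/12`, `g₃(Λ) = c₆(W)/216` (i.e. `Λ` is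
the period lattice of `dx/(2y + a₁x + a₃)` on `W`), the analytic parametrisation in the coordinates of `W` is
`ξ(z) = (℘(z) − b₂/12, (℘′(z) − a₁(℘(z) − b₂/12) − a₃)/2)` (Silverman AEC VI.3.6(b) composed with the change of variables
III.1 to short normal form; tree: `PeriodPair.exists_addMonoidHom_of_g₂_g₃`, additivity `PeriodPair.toPoint_add_holds`).
De Shalit (II.1.5 (15), II.4.4, II.4.9) reads the division points `ξ(u)`, `u ∈ 𝔠⁻¹Λ`, through their ALGEBRAIC coordinates
`x, y ∈ K(𝔣ψ𝔠) ⊂ K̄` (`ι̂ x = ℘(u)`, `ι̂ y = ℘′(u)`) and then inside a local field along `ι_v : K̄ → K̄_v`.  This file supplies: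

* §1 (over `ℂ`, any model) ★ `PeriodPair.nonsingular_model_of_notMem` — `ξ(z)` is a nonsingular affine point of `W` (`z ∉ Λ`);
  ★★ `PeriodPair.some_model_add_some_model` — `ξ(z₁) + ξ(z₂) = ξ(z₁ + z₂)` in `W(ℂ)` (`zᵢ, z₁ + z₂ ∉ Λ`);
  `PeriodPair.some_model_add_some_model_eq_zero` (`z₁ + z₂ ∈ Λ`), `PeriodPair.neg_some_model` (`−ξ(z) = ξ(−z)`),
  `PeriodPair.some_model_eq_some_model_iff` (`ξ(z) = ξ(w) ↔ z − w ∈ Λ`), ★ `PeriodPair.addOrderOf_some_model_eq` (the order of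
  `ξ(z)` in `W(ℂ)` = the order of `toPoint z` on `E_Λ` = the order of `z` in `ℂ/Λ`; `nsmul_some_model_eq_zero_iff`, `nsmul_toPoint_eq_zero_iff`);
* §2 (transport, any `W/ℤ`, fields `A → B`) `baseChange_eq_map_intCastRingHom`, `nonsingular_baseChange_map_iff` and ★ `some_add_some_eq_some_iff_map`,
  `some_add_some_eq_zero_iff_map`, `neg_some_eq_some_iff_map`, `some_eq_some_iff_map`, `addOrderOf_some_map_eq` — identities / orders of affine points with
  coordinates `f xᵢ, f yᵢ` on `W ⊗ B` ⟺ the same identities on `W ⊗ A` (`WeierstrassCurve.Affine.Point.map` is an injective group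
  homomorphism) — so that an identity proved over `ℂ` descends to `K̄` along `ι̂` and is pushed to `K̄_v`, then reflected into any
  intermediate field `M` containing the coordinates;
* §3 (algebraic coordinates) ★★ `nonsingular_of_map_eq_model` / `some_add_some_eq_some_of_map_eq_model` /
  `some_add_some_eq_zero_of_map_eq_model` / ★ `addOrderOf_some_of_map_eq_model` — for a field `A` with a ring map `φ : A →+* ℂ` and `x y : A` with
  `φ x = ℘(z) − b₂/12`, `φ y = (℘′(z) − a₁(℘(z) − b₂/12) − a₃)/2` (on the model `W ⊗ ℂ` of `W/ℤ`): `(x, y)` is a nonsingular point of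
  `W ⊗ A`, these points ADD like the `z`'s, and their ORDERS are those of the `z`'s in `ℂ/Λ` (B9's (N2) input).

What is NOT here: the membership of the coordinates in a prescribed local field (`RayClassFieldLocalTowerContainment`), torsion orders,
the formal-group chart (`FormalGroupNilIdealPoints`).  Everything is a theorem; no named facts, no definitions, no instances, no `sorry`.

## References
* [SilvermanAEC2009] J. H. Silverman, *The Arithmetic of Elliptic Curves*, 2nd ed. (2009), Prop. VI.3.6(b), III.1, III.2.3 / III.3.1(b).
* [deShalit1987] E. de Shalit, *Iwasawa theory of elliptic curves with complex multiplication* (1987), II.1.5 (15) (p. 42), II.4.4 (p. 57–58),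
  II.4.9 (p. 62–63).
-/

noncomputable section

open Complex
open scoped Classical PeriodPair

/-! ## §1. The points `ξ(z)` on an arbitrary model over `ℂ` and their group law -/

namespace PeriodPair

variable (L : PeriodPair) {W : WeierstrassCurve ℂ} (h₂ : L.g₂ = W.c₄ / 12) (h₃ : L.g₃ = W.c₆ / 216)

include h₂ h₃ in
/-- ★ **`ξ(z) = (℘(z) − b₂/12, (℘′(z) − a₁(℘(z) − b₂/12) − a₃)/2)` is a nonsingular point of the model `W`** (`z ∉ Λ`,
`g₂(Λ) = c₄(W)/12`, `g₃(Λ) = c₆(W)/216`): the point `(℘(z), ℘′(z)/2)` of `E_Λ` pulled back along Mathlib's change of variables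
`W.toShortNF` (`W.toShortNF • W = E_Λ`). [cite: SilvermanAEC2009, Prop. VI.3.6(b), III.1] -/
theorem nonsingular_model_of_notMem {z : ℂ} (hz : z ∉ L.lattice) :
    W.toAffine.Nonsingular (℘[L] z - W.b₂ / 12) ((℘'[L] z - W.a₁ * (℘[L] z - W.b₂ / 12) - W.a₃) / 2) := by
  set C := W.toShortNF with hCdef
  have hz' : (C • W).toAffine.Nonsingular (℘[L] z) (℘'[L] z / 2) := by
    rw [toShortNF_smul_eq_curve h₂ h₃]; exact nonsingular_weierstrassP hz
  have hx : C.ofX (℘[L] z) = ℘[L] z - W.b₂ / 12 := by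
    simp only [WeierstrassCurve.VariableChange.ofX_def, hCdef, W.toShortNF_eq, Units.val_one, one_pow, one_mul]
    ring
  have hy : C.ofY (℘[L] z) (℘'[L] z / 2) = (℘'[L] z - W.a₁ * (℘[L] z - W.b₂ / 12) - W.a₃) / 2 := by
    simp only [WeierstrassCurve.VariableChange.ofY_def, hCdef, W.toShortNF_eq, Units.val_one, one_pow, one_mul]
    ring
  have hns := (WeierstrassCurve.VariableChange.nonsingular_ofXY_iff W C _ _).mpr hz'
  rwa [hx, hy] at hns

include h₂ h₃ in
/-- ★★ **The group law of the `ξ(z)`: `ξ(z₁) + ξ(z₂) = ξ(z₁ + z₂)` in `W(ℂ)`** for `z₁, z₂, z₁ + z₂ ∉ Λ` (Silverman AEC VI.3.6(b): `φ` is a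
homomorphism — the tree's `toPoint_add_holds` — transported to the model `W` by `exists_addMonoidHom_of_g₂_g₃`).
[cite: SilvermanAEC2009, Prop. VI.3.6(b), III.3.1(b)] -/
theorem some_model_add_some_model {z₁ z₂ : ℂ} (hz₁ : z₁ ∉ L.lattice) (hz₂ : z₂ ∉ L.lattice) (hz : z₁ + z₂ ∉ L.lattice) :
    (.some _ _ (nonsingular_model_of_notMem L h₂ h₃ hz₁) : W.toAffine.Point) + .some _ _ (nonsingular_model_of_notMem L h₂ h₃ hz₂) =
      .some _ _ (nonsingular_model_of_notMem L h₂ h₃ hz) := by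
  obtain ⟨u, -, -, hspec⟩ := exists_addMonoidHom_of_g₂_g₃ (L := L) (toPoint_add_holds L) h₂ h₃
  obtain ⟨_, hu₁⟩ := hspec z₁ hz₁
  obtain ⟨_, hu₂⟩ := hspec z₂ hz₂
  obtain ⟨_, hu⟩ := hspec (z₁ + z₂) hz
  have h := map_add u z₁ z₂
  rw [hu₁, hu₂, hu] at h
  exact h.symm

include h₂ h₃ in
/-- **`ξ(z₁) + ξ(z₂) = O` when `z₁ + z₂ ∈ Λ`** (`zᵢ ∉ Λ`). [cite: SilvermanAEC2009, Prop. VI.3.6(b)] -/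
theorem some_model_add_some_model_eq_zero {z₁ z₂ : ℂ} (hz₁ : z₁ ∉ L.lattice) (hz₂ : z₂ ∉ L.lattice) (hz : z₁ + z₂ ∈ L.lattice) :
    (.some _ _ (nonsingular_model_of_notMem L h₂ h₃ hz₁) : W.toAffine.Point) + .some _ _ (nonsingular_model_of_notMem L h₂ h₃ hz₂) = 0 := by
  obtain ⟨u, hker, -, hspec⟩ := exists_addMonoidHom_of_g₂_g₃ (L := L) (toPoint_add_holds L) h₂ h₃
  obtain ⟨_, hu₁⟩ := hspec z₁ hz₁
  obtain ⟨_, hu₂⟩ := hspec z₂ hz₂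
  have h0 : u (z₁ + z₂) = 0 := by
    have hmem : z₁ + z₂ ∈ (u.ker : Set ℂ) := by rw [hker]; exact hz
    exact (AddMonoidHom.mem_ker).mp hmem
  rw [← hu₁, ← hu₂, ← map_add, h0]

include h₂ h₃ in
/-- **`−ξ(z) = ξ(−z)`** (`z ∉ Λ`). [cite: SilvermanAEC2009, Prop. VI.3.6(b)] -/
theorem neg_some_model {z : ℂ} (hz : z ∉ L.lattice) (hz' : -z ∉ L.lattice) :
    -(.some _ _ (nonsingular_model_of_notMem L h₂ h₃ hz) : W.toAffine.Point) = .some _ _ (nonsingular_model_of_notMem L h₂ h₃ hz') := by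
  obtain ⟨u, -, -, hspec⟩ := exists_addMonoidHom_of_g₂_g₃ (L := L) (toPoint_add_holds L) h₂ h₃
  obtain ⟨_, hu₁⟩ := hspec z hz
  obtain ⟨_, hu₂⟩ := hspec (-z) hz'
  rw [← hu₁, ← hu₂, map_neg]

include h₂ h₃ in
/-- **`ξ(z) = ξ(w) ↔ z − w ∈ Λ`** (`z, w ∉ Λ`; injectivity of VI.3.6(b) on `ℂ/Λ`). [cite: SilvermanAEC2009, Prop. VI.3.6(b)] -/
theorem some_model_eq_some_model_iff {z w : ℂ} (hz : z ∉ L.lattice) (hw : w ∉ L.lattice) :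
    (.some _ _ (nonsingular_model_of_notMem L h₂ h₃ hz) : W.toAffine.Point) = .some _ _ (nonsingular_model_of_notMem L h₂ h₃ hw) ↔
      z - w ∈ L.lattice := by
  obtain ⟨u, hker, -, hspec⟩ := exists_addMonoidHom_of_g₂_g₃ (L := L) (toPoint_add_holds L) h₂ h₃
  obtain ⟨_, hu₁⟩ := hspec z hz
  obtain ⟨_, hu₂⟩ := hspec w hw
  rw [← hu₁, ← hu₂, ← sub_eq_zero, ← map_sub]
  have hk : ∀ t : ℂ, u t = 0 ↔ t ∈ L.lattice := fun t ↦ by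
    rw [← AddMonoidHom.mem_ker, ← SetLike.mem_coe, hker]; exact Iff.rfl
  exact hk (z - w)

include h₂ h₃ in
/-- **`n • ξ(z) = O ↔ n·z ∈ Λ`** in `W(ℂ)` (`z ∉ Λ`). [cite: SilvermanAEC2009, Prop. VI.3.6(b)] -/
theorem nsmul_some_model_eq_zero_iff {z : ℂ} (hz : z ∉ L.lattice) (n : ℕ) :
    n • (.some _ _ (nonsingular_model_of_notMem L h₂ h₃ hz) : W.toAffine.Point) = 0 ↔ (n : ℂ) * z ∈ L.lattice := by
  obtain ⟨u, hker, -, hspec⟩ := exists_addMonoidHom_of_g₂_g₃ (L := L) (toPoint_add_holds L) h₂ h₃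
  obtain ⟨_, hu₁⟩ := hspec z hz
  rw [← hu₁, ← map_nsmul, nsmul_eq_mul, ← AddMonoidHom.mem_ker, ← SetLike.mem_coe, hker]
  exact Iff.rfl

/-- **`n • toPoint z = O ↔ n·z ∈ Λ`** on `E_Λ(ℂ)` (any `z`). [cite: SilvermanAEC2009, Prop. VI.3.6(b)] -/
theorem nsmul_toPoint_eq_zero_iff (z : ℂ) (n : ℕ) : n • L.toPoint z = 0 ↔ (n : ℂ) * z ∈ L.lattice := by
  rw [← toPoint_eq_zero_iff (L := L), ← nsmul_eq_mul]
  exact (congrArg (· = 0) (map_nsmul (toPointHom (toPoint_add_holds L)) n z)).to_iff.symm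

include h₂ h₃ in
/-- ★ **The order of `ξ(z)` in `W(ℂ)` is the order of `z` in `ℂ/Λ`** (= the order of `toPoint z` on `E_Λ`): the change of variables
to the model is a group isomorphism. [cite: SilvermanAEC2009, Prop. VI.3.6(b), III.3.1(b)] -/
theorem addOrderOf_some_model_eq {z : ℂ} (hz : z ∉ L.lattice) :
    addOrderOf (.some _ _ (nonsingular_model_of_notMem L h₂ h₃ hz) : W.toAffine.Point) = addOrderOf (L.toPoint z) := by
  rw [addOrderOf_eq_addOrderOf_iff]
  intro n
  rw [nsmul_some_model_eq_zero_iff L h₂ h₃ hz, nsmul_toPoint_eq_zero_iff]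

end PeriodPair

/-! ## §2. Transport of point identities along ring maps (`W/ℤ`, fields `A → B`) -/

namespace Literature.NumberTheory.EllipticCurves

section Transport

variable (W : WeierstrassCurve ℤ) {A B : Type*} [Field A] [Field B] (f : A →+* B)

/-- `W ⊗ A` (Mathlib's `baseChange`, along `algebraMap ℤ A`) IS `W.map (Int.castRingHom A)` — the presentation of the tree's
`curveOver_map_map_intCast` (`FormalGroupLubinTateDivisionPointsDegreeOne`). [cite: SilvermanAEC2009, III.1] -/
theorem baseChange_eq_map_intCastRingHom (A : Type*) [Field A] : W.baseChange A = W.map (Int.castRingHom A) := by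
  rw [WeierstrassCurve.baseChange, algebraMap_int_eq]

/-- Nonsingularity of `(f x, f y)` on `W ⊗ B` ⟺ of `(x, y)` on `W ⊗ A` (Mathlib `baseChange_nonsingular`, `f` injective).
[cite: SilvermanAEC2009, III.1] -/
theorem nonsingular_baseChange_map_iff (x y : A) :
    (W.baseChange B).toAffine.Nonsingular (f x) (f y) ↔ (W.baseChange A).toAffine.Nonsingular x y :=
  WeierstrassCurve.Affine.baseChange_nonsingular (W := W.toAffine) (f := f.toIntAlgHom) f.injective x y

/-- `Point.map f` sends `(x, y)` to `(f x, f y)` (any nonsingularity witnesses). [cite: SilvermanAEC2009, III.2.3] -/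
theorem map_some_eq {x y : A} (h : (W.baseChange A).toAffine.Nonsingular x y) (h' : (W.baseChange B).toAffine.Nonsingular (f x) (f y)) :
    WeierstrassCurve.Affine.Point.map (W' := W.toAffine) f.toIntAlgHom (.some x y h) = .some (f x) (f y) h' := by
  rw [WeierstrassCurve.Affine.Point.map_some]
  rfl

/-- ★ **`P₁ + P₂ = P₃` over `B` ⟺ over `A`** for affine points with coordinates `f xᵢ, f yᵢ` (`Point.map f` is an injective group
homomorphism; any nonsingularity witnesses on both sides). [cite: SilvermanAEC2009, III.2.3] -/
theorem some_add_some_eq_some_iff_map {x₁ y₁ x₂ y₂ x₃ y₃ : A}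
    (h₁ : (W.baseChange A).toAffine.Nonsingular x₁ y₁) (h₂ : (W.baseChange A).toAffine.Nonsingular x₂ y₂)
    (h₃ : (W.baseChange A).toAffine.Nonsingular x₃ y₃)
    (h₁' : (W.baseChange B).toAffine.Nonsingular (f x₁) (f y₁)) (h₂' : (W.baseChange B).toAffine.Nonsingular (f x₂) (f y₂))
    (h₃' : (W.baseChange B).toAffine.Nonsingular (f x₃) (f y₃)) :
    (.some _ _ h₁' : (W.baseChange B).toAffine.Point) + .some _ _ h₂' = .some _ _ h₃' ↔
      (.some _ _ h₁ : (W.baseChange A).toAffine.Point) + .some _ _ h₂ = .some _ _ h₃ := by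
  rw [← map_some_eq W f h₁ h₁', ← map_some_eq W f h₂ h₂', ← map_some_eq W f h₃ h₃', ← map_add]
  exact (WeierstrassCurve.Affine.Point.map_injective (W' := W.toAffine) (f := f.toIntAlgHom)).eq_iff

/-- **`P₁ + P₂ = O` over `B` ⟺ over `A`** (affine points with coordinates `f xᵢ, f yᵢ`). [cite: SilvermanAEC2009, III.2.3] -/
theorem some_add_some_eq_zero_iff_map {x₁ y₁ x₂ y₂ : A}
    (h₁ : (W.baseChange A).toAffine.Nonsingular x₁ y₁) (h₂ : (W.baseChange A).toAffine.Nonsingular x₂ y₂)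
    (h₁' : (W.baseChange B).toAffine.Nonsingular (f x₁) (f y₁)) (h₂' : (W.baseChange B).toAffine.Nonsingular (f x₂) (f y₂)) :
    (.some _ _ h₁' : (W.baseChange B).toAffine.Point) + .some _ _ h₂' = 0 ↔
      (.some _ _ h₁ : (W.baseChange A).toAffine.Point) + .some _ _ h₂ = 0 := by
  rw [← map_some_eq W f h₁ h₁', ← map_some_eq W f h₂ h₂', ← map_add,
    ← map_zero (WeierstrassCurve.Affine.Point.map (W' := W.toAffine) f.toIntAlgHom)]
  exact (WeierstrassCurve.Affine.Point.map_injective (W' := W.toAffine) (f := f.toIntAlgHom)).eq_iff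

/-- **`−P₁ = P₂` over `B` ⟺ over `A`** (affine points with coordinates `f xᵢ, f yᵢ`). [cite: SilvermanAEC2009, III.2.3] -/
theorem neg_some_eq_some_iff_map {x₁ y₁ x₂ y₂ : A}
    (h₁ : (W.baseChange A).toAffine.Nonsingular x₁ y₁) (h₂ : (W.baseChange A).toAffine.Nonsingular x₂ y₂)
    (h₁' : (W.baseChange B).toAffine.Nonsingular (f x₁) (f y₁)) (h₂' : (W.baseChange B).toAffine.Nonsingular (f x₂) (f y₂)) :
    -(.some _ _ h₁' : (W.baseChange B).toAffine.Point) = .some _ _ h₂' ↔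
      -(.some _ _ h₁ : (W.baseChange A).toAffine.Point) = .some _ _ h₂ := by
  rw [← map_some_eq W f h₁ h₁', ← map_some_eq W f h₂ h₂', ← map_neg]
  exact (WeierstrassCurve.Affine.Point.map_injective (W' := W.toAffine) (f := f.toIntAlgHom)).eq_iff

/-- **`P₁ = P₂` over `B` ⟺ over `A`** (affine points with coordinates `f xᵢ, f yᵢ`). [cite: SilvermanAEC2009, III.2.3] -/
theorem some_eq_some_iff_map {x₁ y₁ x₂ y₂ : A}
    (h₁ : (W.baseChange A).toAffine.Nonsingular x₁ y₁) (h₂ : (W.baseChange A).toAffine.Nonsingular x₂ y₂)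
    (h₁' : (W.baseChange B).toAffine.Nonsingular (f x₁) (f y₁)) (h₂' : (W.baseChange B).toAffine.Nonsingular (f x₂) (f y₂)) :
    (.some _ _ h₁' : (W.baseChange B).toAffine.Point) = .some _ _ h₂' ↔
      (.some _ _ h₁ : (W.baseChange A).toAffine.Point) = .some _ _ h₂ := by
  rw [← map_some_eq W f h₁ h₁', ← map_some_eq W f h₂ h₂']
  exact (WeierstrassCurve.Affine.Point.map_injective (W' := W.toAffine) (f := f.toIntAlgHom)).eq_iff

/-- **Orders are preserved**: `addOrderOf (f x, f y) = addOrderOf (x, y)` (`Point.map f` injective). [cite: SilvermanAEC2009, III.2.3] -/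
theorem addOrderOf_some_map_eq {x y : A} (h : (W.baseChange A).toAffine.Nonsingular x y)
    (h' : (W.baseChange B).toAffine.Nonsingular (f x) (f y)) :
    addOrderOf (.some _ _ h' : (W.baseChange B).toAffine.Point) = addOrderOf (.some _ _ h : (W.baseChange A).toAffine.Point) := by
  rw [← map_some_eq W f h h']
  exact addOrderOf_injective _ (WeierstrassCurve.Affine.Point.map_injective (W' := W.toAffine) (f := f.toIntAlgHom)) _

end Transport

/-! ## §3. Points with algebraic coordinates read through `φ : A →+* ℂ` -/

section Algebraic

variable (W : WeierstrassCurve ℤ) (L : PeriodPair) {A : Type*} [Field A] (φ : A →+* ℂ)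
  (h₂ : L.g₂ = (W.baseChange ℂ).c₄ / 12) (h₃ : L.g₃ = (W.baseChange ℂ).c₆ / 216)

include h₂ h₃ in
/-- ★★ **A point with algebraic coordinates**: if `φ x = ℘(z) − b₂/12` and `φ y = (℘′(z) − a₁(℘(z) − b₂/12) − a₃)/2` (`z ∉ Λ`; `W/ℤ`
read in `ℂ`, `g₂(Λ) = c₄/12`, `g₃(Λ) = c₆/216`), then `(x, y)` is a nonsingular point of `W ⊗ A` (de Shalit II.1.5 (15): the
coordinates of `ξ(u)` lie in `K(𝔣ψ𝔠)`). [cite: SilvermanAEC2009, Prop. VI.3.6(b), III.1] [cite: deShalit1987, II.1.5 (15) (p. 42)] -/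
theorem nonsingular_of_map_eq_model {z : ℂ} (hz : z ∉ L.lattice) {x y : A}
    (hx : φ x = ℘[L] z - (W.baseChange ℂ).b₂ / 12)
    (hy : φ y = (℘'[L] z - (W.baseChange ℂ).a₁ * (℘[L] z - (W.baseChange ℂ).b₂ / 12) - (W.baseChange ℂ).a₃) / 2) :
    (W.baseChange A).toAffine.Nonsingular x y := by
  rw [← nonsingular_baseChange_map_iff W φ, hx, hy]
  exact L.nonsingular_model_of_notMem h₂ h₃ hz

include h₂ h₃ in
/-- ★★ **Points with algebraic coordinates add like their arguments**: `P(z₁) + P(z₂) = P(z₁ + z₂)` in `(W ⊗ A)(A)` when the three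
points have coordinates in `A` read by `φ` as the `ξ(zᵢ)` and `z₁, z₂, z₁ + z₂ ∉ Λ` (§1 over `ℂ`, descended along the injective
`Point.map φ`). [cite: SilvermanAEC2009, Prop. VI.3.6(b), III.2.3] [cite: deShalit1987, II.4.9 (p. 62–63)] -/
theorem some_add_some_eq_some_of_map_eq_model {z₁ z₂ : ℂ} (hz₁ : z₁ ∉ L.lattice) (hz₂ : z₂ ∉ L.lattice) (hz : z₁ + z₂ ∉ L.lattice)
    {x₁ y₁ x₂ y₂ x₃ y₃ : A}
    (hx₁ : φ x₁ = ℘[L] z₁ - (W.baseChange ℂ).b₂ / 12)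
    (hy₁ : φ y₁ = (℘'[L] z₁ - (W.baseChange ℂ).a₁ * (℘[L] z₁ - (W.baseChange ℂ).b₂ / 12) - (W.baseChange ℂ).a₃) / 2)
    (hx₂ : φ x₂ = ℘[L] z₂ - (W.baseChange ℂ).b₂ / 12)
    (hy₂ : φ y₂ = (℘'[L] z₂ - (W.baseChange ℂ).a₁ * (℘[L] z₂ - (W.baseChange ℂ).b₂ / 12) - (W.baseChange ℂ).a₃) / 2)
    (hx₃ : φ x₃ = ℘[L] (z₁ + z₂) - (W.baseChange ℂ).b₂ / 12)
    (hy₃ : φ y₃ = (℘'[L] (z₁ + z₂) - (W.baseChange ℂ).a₁ * (℘[L] (z₁ + z₂) - (W.baseChange ℂ).b₂ / 12) - (W.baseChange ℂ).a₃) / 2)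
    (h₁ : (W.baseChange A).toAffine.Nonsingular x₁ y₁) (h₂' : (W.baseChange A).toAffine.Nonsingular x₂ y₂)
    (h₃' : (W.baseChange A).toAffine.Nonsingular x₃ y₃) :
    (.some _ _ h₁ : (W.baseChange A).toAffine.Point) + .some _ _ h₂' = .some _ _ h₃' := by
  have h₁c := (nonsingular_baseChange_map_iff W φ x₁ y₁).mpr h₁
  have h₂c := (nonsingular_baseChange_map_iff W φ x₂ y₂).mpr h₂'
  have h₃c := (nonsingular_baseChange_map_iff W φ x₃ y₃).mpr h₃'
  rw [← some_add_some_eq_some_iff_map W φ h₁ h₂' h₃' h₁c h₂c h₃c]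
  have key := L.some_model_add_some_model h₂ h₃ hz₁ hz₂ hz
  simp only [hx₁, hy₁, hx₂, hy₂, hx₃, hy₃]
  exact key

include h₂ h₃ in
/-- **`P(z₁) + P(z₂) = O` in `(W ⊗ A)(A)` when `z₁ + z₂ ∈ Λ`** (coordinates read by `φ` as the `ξ(zᵢ)`).
[cite: SilvermanAEC2009, Prop. VI.3.6(b), III.2.3] -/
theorem some_add_some_eq_zero_of_map_eq_model {z₁ z₂ : ℂ} (hz₁ : z₁ ∉ L.lattice) (hz₂ : z₂ ∉ L.lattice) (hz : z₁ + z₂ ∈ L.lattice)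
    {x₁ y₁ x₂ y₂ : A}
    (hx₁ : φ x₁ = ℘[L] z₁ - (W.baseChange ℂ).b₂ / 12)
    (hy₁ : φ y₁ = (℘'[L] z₁ - (W.baseChange ℂ).a₁ * (℘[L] z₁ - (W.baseChange ℂ).b₂ / 12) - (W.baseChange ℂ).a₃) / 2)
    (hx₂ : φ x₂ = ℘[L] z₂ - (W.baseChange ℂ).b₂ / 12)
    (hy₂ : φ y₂ = (℘'[L] z₂ - (W.baseChange ℂ).a₁ * (℘[L] z₂ - (W.baseChange ℂ).b₂ / 12) - (W.baseChange ℂ).a₃) / 2)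
    (h₁ : (W.baseChange A).toAffine.Nonsingular x₁ y₁) (h₂' : (W.baseChange A).toAffine.Nonsingular x₂ y₂) :
    (.some _ _ h₁ : (W.baseChange A).toAffine.Point) + .some _ _ h₂' = 0 := by
  have h₁c := (nonsingular_baseChange_map_iff W φ x₁ y₁).mpr h₁
  have h₂c := (nonsingular_baseChange_map_iff W φ x₂ y₂).mpr h₂'
  rw [← some_add_some_eq_zero_iff_map W φ h₁ h₂' h₁c h₂c]
  have key := L.some_model_add_some_model_eq_zero h₂ h₃ hz₁ hz₂ hz
  simp only [hx₁, hy₁, hx₂, hy₂]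
  exact key

include h₂ h₃ in
/-- **`P(z) = P(w) ↔ z − w ∈ Λ` in `(W ⊗ A)(A)`** (coordinates read by `φ`). [cite: SilvermanAEC2009, Prop. VI.3.6(b)] -/
theorem some_eq_some_iff_of_map_eq_model {z w : ℂ} (hz : z ∉ L.lattice) (hw : w ∉ L.lattice) {x₁ y₁ x₂ y₂ : A}
    (hx₁ : φ x₁ = ℘[L] z - (W.baseChange ℂ).b₂ / 12)
    (hy₁ : φ y₁ = (℘'[L] z - (W.baseChange ℂ).a₁ * (℘[L] z - (W.baseChange ℂ).b₂ / 12) - (W.baseChange ℂ).a₃) / 2)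
    (hx₂ : φ x₂ = ℘[L] w - (W.baseChange ℂ).b₂ / 12)
    (hy₂ : φ y₂ = (℘'[L] w - (W.baseChange ℂ).a₁ * (℘[L] w - (W.baseChange ℂ).b₂ / 12) - (W.baseChange ℂ).a₃) / 2)
    (h₁ : (W.baseChange A).toAffine.Nonsingular x₁ y₁) (h₂' : (W.baseChange A).toAffine.Nonsingular x₂ y₂) :
    (.some _ _ h₁ : (W.baseChange A).toAffine.Point) = .some _ _ h₂' ↔ z - w ∈ L.lattice := by
  have h₁c := (nonsingular_baseChange_map_iff W φ x₁ y₁).mpr h₁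
  have h₂c := (nonsingular_baseChange_map_iff W φ x₂ y₂).mpr h₂'
  rw [← some_eq_some_iff_map W φ h₁ h₂' h₁c h₂c, ← L.some_model_eq_some_model_iff h₂ h₃ hz hw]
  simp only [hx₁, hy₁, hx₂, hy₂]

include h₂ h₃ in
/-- ★ **The order of a point with algebraic coordinates is the order of its argument in `ℂ/Λ`**:
`addOrderOf (x, y) = addOrderOf (toPoint z)` in `(W ⊗ A)(A)` (coordinates read by `φ` as `ξ(z)`; so a primitive `𝔭ⁿ`-division value has
order exactly `N𝔭ⁿ`). [cite: SilvermanAEC2009, Prop. VI.3.6(b), III.2.3] [cite: deShalit1987, II.4.4 (p. 57–58)] -/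
theorem addOrderOf_some_of_map_eq_model {z : ℂ} (hz : z ∉ L.lattice) {x y : A}
    (hx : φ x = ℘[L] z - (W.baseChange ℂ).b₂ / 12)
    (hy : φ y = (℘'[L] z - (W.baseChange ℂ).a₁ * (℘[L] z - (W.baseChange ℂ).b₂ / 12) - (W.baseChange ℂ).a₃) / 2)
    (h : (W.baseChange A).toAffine.Nonsingular x y) :
    addOrderOf (.some _ _ h : (W.baseChange A).toAffine.Point) = addOrderOf (L.toPoint z) := by
  have hc := (nonsingular_baseChange_map_iff W φ x y).mpr h
  rw [← addOrderOf_some_map_eq W φ h hc, ← L.addOrderOf_some_model_eq h₂ h₃ hz]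
  simp only [hx, hy]

end Algebraic

end Literature.NumberTheory.EllipticCurves

end
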